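import Literature.AlgebraicGeometry.Limits.EmbeddedFamilyStageDescent
import Literature.AlgebraicGeometry.Limits.SmoothAffineIntegralModel
import Literature.AlgebraicGeometry.Motives.ProjBaseChangeAny
import HarnessLib

/-!
# A smooth projective family over a smooth affine variety has a smooth projective model over a
# ring of finite type over `ℤ`

Topic `Literature/AlgebraicGeometry/Limits` (EGA IV₃ 8.8.2 (ii), 8.10.5; IV₄ 17.7.8 (ii); the
"spreading out over a finitely generated `ℤ`-algebra" of a FAMILY, Maulik–Poonen 2012, §4). The
family form of the tree's `exists_smooth_projective_model_finiteType_int` (one variety) and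
`exists_smooth_affine_model_finiteType_int` (the base alone): for a field `K`, an integral affine
`K`-scheme `S` smooth of relative dimension `d`, and a closed `S`-subscheme `ι : 𝒳 ↪ S × ℙᴹ_K` with
`𝒳 → S` smooth of relative dimension `n`, there are a ring `R` of finite type over `ℤ` with a ring
map `R → K` (`Algebra R K`), an `R`-algebra `B` of finite type with `Spec B → Spec R` smooth of
relative dimension `d` and `π : S → Spec B` cartesian over `Spec K → Spec R`, and a closed subscheme
`emb : Y ↪ ℙᴹ_B` whose structure morphism `g : Y → Spec B` is proper and smooth of relative
dimension `n`, with `π𝒳 : 𝒳 → Y` cartesian over `π` (`exists_smooth_projective_family_model_finiteType_int`).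

Proof: the base is `Spec (K ⊗_{R₀} C₀)` for a finitely generated subring `R₀ ⊆ K` and an
`R₀`-algebra `C₀` of finite type (`exists_fg_subalgebra_model_of_isAffine`); the closed immersion
`𝒳 ↪ S × ℙᴹ_K ≅ ℙᴹ_{C₀} ×_{R₀} Spec K` descends, with its smoothness and that of the base, to a
localised finitely generated `R₀`-subalgebra `T ⊆ K`
(`exists_stage_closedSubscheme_smoothOfRelativeDimension`); finally
`ℙᴹ_{C₀} ×_{R₀} Spec T = ℙᴹ_B`, `B = T ⊗_{R₀} C₀` (`ProjBaseChangeRing.isPullback_projMap'`).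

Everything is proved; no definitions, no named facts.

## References

* [EGAIV3] A. Grothendieck, J. Dieudonné, EGA IV₃, Thm. 8.8.2 (ii), Thm. 8.10.5.
* [EGAIV4] EGA IV₄, Prop. 17.7.8 (ii).
* [MaulikPoonen2012] D. Maulik, B. Poonen, Néron–Severi groups under specialization, Duke Math.
  J. 161 (2012), §4.
-/

noncomputable section

universe u

open CategoryTheory CategoryTheory.Limits AlgebraicGeometry TopologicalSpace MonoidalCategory
open MvPolynomial
open scoped TensorProduct

namespace Literature.AlgebraicGeometry.Limits

open Literature.AlgebraicGeometry.Motives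
open Literature.AlgebraicGeometry.Motives.ProjBaseChangeRing (projToSpec)

set_option backward.isDefEq.respectTransparency false

/-- **A smooth projective family over a smooth integral affine variety has a smooth projective
model over a ring of finite type over `ℤ`** (EGA IV₃ 8.8.2 (ii), 8.10.5 (v), (xii); IV₄ 17.7.8
(ii); Maulik–Poonen 2012, §4, for families). Let `K` be a field, `S` an integral affine `K`-scheme
smooth of relative dimension `d`, `f : 𝒳 → S` a `K`-morphism smooth of relative dimension `n`
and `ι : 𝒳 ↪ S × ℙᴹ_K` a closed `K`-immersion over `S` (`ι ≫ pr₁ = f`). Then there are: a ring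
`R` of finite type over `ℤ` with a ring map `R → K`; an `R`-algebra `B` of finite type with
`Spec B → Spec R` smooth of relative dimension `d` and `π : S → Spec B` cartesian over
`Spec K → Spec R`; a closed subscheme `emb : Y ↪ ℙᴹ_B` with structure morphism
`g = emb ≫ (ℙᴹ_B → Spec B)` proper and smooth of relative dimension `n`; and `π𝒳 : 𝒳 → Y` with
`(π𝒳, f; g, π)` cartesian. [cite: EGAIV4, Prop. 17.7.8 (ii)] [cite: EGAIV3, Thm. 8.10.5]
[cite: MaulikPoonen2012, §4] -/
theorem exists_smooth_projective_family_model_finiteType_int {K : Type u} [Field K] {d n M : ℕ}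
    (S : SchemeOver K) [IsAffine S.left] [IsIntegral S.left] [SmoothOfRelativeDimension d S.hom]
    {𝒳 : SchemeOver K} (f : 𝒳 ⟶ S) [SmoothOfRelativeDimension n f.left]
    (ι : 𝒳 ⟶ S ⊗ projectiveSpace M K) [IsClosedImmersion ι.left]
    (hι : ι ≫ CartesianMonoidalCategory.fst S (projectiveSpace M K) = f) :
    ∃ (R : Type u) (_ : CommRing R) (_ : Algebra R K) (_ : Algebra.FiniteType ℤ R)
      (B : Type u) (_ : CommRing B) (_ : Algebra R B) (_ : Algebra.FiniteType R B)
      (π : S.left ⟶ Spec (.of B)) (Y : Scheme.{u}) (g : Y ⟶ Spec (.of B))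
      (emb : letI := MvPolynomial.gradedAlgebra (σ := Fin (M + 1)) (R := B)
        Y ⟶ Proj (homogeneousSubmodule (Fin (M + 1)) B)) (_ : IsClosedImmersion emb)
      (_ : letI := MvPolynomial.gradedAlgebra (σ := Fin (M + 1)) (R := B)
        emb ≫ projToSpec (Fin (M + 1)) B = g)
      (π𝒳 : 𝒳.left ⟶ Y),
      SmoothOfRelativeDimension d (Spec.map (CommRingCat.ofHom (algebraMap R B))) ∧
      IsPullback π S.hom (Spec.map (CommRingCat.ofHom (algebraMap R B)))
        (Spec.map (CommRingCat.ofHom (algebraMap R K))) ∧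
      IsProper g ∧ SmoothOfRelativeDimension n g ∧ IsPullback π𝒳 f.left g π := by
  classical
  letI := MvPolynomial.gradedAlgebra (σ := Fin (M + 1)) (R := K)
  haveI : Smooth S.hom := SmoothOfRelativeDimension.smooth d S.hom
  -- 1. the model of the base: `Γ(S) ≅ K ⊗_{R₀} C₀`
  obtain ⟨R₀, C₀, _, _, _, e₀, hR₀fg, hC₀ft, -, he₀⟩ := exists_fg_subalgebra_model_of_isAffine S
  letI := MvPolynomial.gradedAlgebra (σ := Fin (M + 1)) (R := C₀)
  letI := MvPolynomial.gradedAlgebra (σ := Fin (M + 1)) (R := (R₀ : Type u))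
  haveI : Algebra.FiniteType ℤ R₀ := (Subalgebra.fg_iff_finiteType _).mp hR₀fg
  haveI : IsNoetherianRing R₀ := Algebra.FiniteType.isNoetherianRing ℤ R₀
  haveI : Algebra.FiniteType R₀ C₀ := hC₀ft
  obtain ⟨π₀, sq₀⟩ := isPullback_of_tensorProduct_algEquiv S C₀ e₀ he₀
  -- `S ≅ Spec C₀ ⊗ Spec K`
  have sq₀' : IsPullback π₀ S.hom (specOver R₀ C₀).hom (specOver R₀ K).hom := sq₀
  let eS : S.left ≅ (specOver R₀ C₀ ⊗ specOver R₀ K).left := sq₀'.isoPullback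
  have heS_fst : eS.hom ≫ pullback.fst (specOver R₀ C₀).hom (specOver R₀ K).hom = π₀ :=
    sq₀'.isoPullback_hom_fst
  have heS_snd : eS.hom ≫ pullback.snd (specOver R₀ C₀).hom (specOver R₀ K).hom = S.hom :=
    sq₀'.isoPullback_hom_snd
  have heS_inv_snd : eS.inv ≫ S.hom = pullback.snd (specOver R₀ C₀).hom (specOver R₀ K).hom :=
    sq₀'.isoPullback_inv_snd
  -- 2. `ℙᴹ_{C₀}` as an `R₀`-scheme over `Spec C₀` (the structure morphism is kept opaque)
  obtain ⟨pr, hpr⟩ : ∃ pr : Proj (homogeneousSubmodule (Fin (M + 1)) C₀) ⟶ Spec (.of C₀),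
      pr = projToSpec (Fin (M + 1)) C₀ := ⟨_, rfl⟩
  haveI hPproper : IsProper pr := by
    rw [hpr]; exact ProjBaseChangeRing.isProper_projToSpec _ C₀
  haveI : QuasiCompact pr := inferInstance
  haveI : IsSeparated pr := inferInstance
  haveI : QuasiSeparated pr := inferInstance
  haveI : LocallyOfFiniteType pr := inferInstance
  haveI : IsAffineHom (specOver R₀ C₀).hom := by
    change IsAffineHom (Spec.map _); infer_instance
  haveI : LocallyOfFiniteType (specOver R₀ C₀).hom := by
    change LocallyOfFiniteType (Spec.map _)
    rw [HasRingHomProperty.Spec_iff (P := @LocallyOfFiniteType)]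
    exact RingHom.finiteType_algebraMap.mpr inferInstance
  haveI : QuasiCompact (specOver R₀ C₀).hom := inferInstance
  haveI : IsSeparated (specOver R₀ C₀).hom := inferInstance
  haveI : QuasiSeparated (specOver R₀ C₀).hom := inferInstance
  let P₀ : SchemeOver R₀ := Over.mk (pr ≫ (specOver R₀ C₀).hom)
  let p₀ : P₀ ⟶ specOver R₀ C₀ := Over.homMk pr rfl
  have hp₀ : p₀.left = pr := rfl
  have hP₀hom : P₀.hom = pr ≫ (specOver R₀ C₀).hom := rfl
  haveI : LocallyOfFiniteType P₀.hom := by rw [hP₀hom]; infer_instance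
  haveI : QuasiCompact P₀.hom := by rw [hP₀hom]; infer_instance
  haveI : QuasiSeparated P₀.hom := by rw [hP₀hom]; infer_instance
  haveI : IsSeparated P₀.hom := by rw [hP₀hom]; infer_instance
  -- the two base-change squares of projective space (structure morphisms kept opaque)
  obtain ⟨prR, hprR⟩ : ∃ prR : Proj (homogeneousSubmodule (Fin (M + 1)) (R₀ : Type u)) ⟶
      Spec (.of (R₀ : Type u)), prR = projToSpec (Fin (M + 1)) (R₀ : Type u) := ⟨_, rfl⟩
  obtain ⟨prK, hprK⟩ : ∃ prK : Proj (homogeneousSubmodule (Fin (M + 1)) K) ⟶ Spec (.of K),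
      prK = projToSpec (Fin (M + 1)) K := ⟨_, rfl⟩
  have sqC : IsPullback (Proj.map _ (ProjBaseChangeRing.irrelevant_le_map R₀ C₀ (Fin (M + 1)))) pr
      prR (Spec.map (CommRingCat.ofHom (algebraMap R₀ C₀))) := by
    rw [hpr, hprR]
    exact ProjBaseChangeRing.isPullback_projMap' (k := (R₀ : Type u)) (L := C₀) (n := M)
  have sqK : IsPullback (Proj.map _ (ProjBaseChangeRing.irrelevant_le_map R₀ K (Fin (M + 1)))) prK
      prR (Spec.map (CommRingCat.ofHom (algebraMap R₀ K))) := by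
    rw [hprK, hprR]
    exact ProjBaseChangeRing.isPullback_projMap' (k := (R₀ : Type u)) (L := K) (n := M)
  have hPK : (projectiveSpace M K).hom = prK := by rw [hprK]; rfl
  -- 3. the closed immersion `j : 𝒳 ↪ ℙᴹ_{C₀} ⊗ Spec K`
  have hιfst : ι.left ≫ pullback.fst S.hom (projectiveSpace M K).hom = f.left := by
    rw [← hι]; rfl
  have hε : ι.left ≫ pullback.snd S.hom (projectiveSpace M K).hom ≫ prK = 𝒳.hom := by
    rw [← hPK, ← pullback.condition, reassoc_of% hιfst, Over.w f]
  let a : 𝒳.left ⟶ Proj (homogeneousSubmodule (Fin (M + 1)) C₀) :=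
    sqC.lift ((ι.left ≫ pullback.snd S.hom (projectiveSpace M K).hom) ≫
      Proj.map _ (ProjBaseChangeRing.irrelevant_le_map R₀ K (Fin (M + 1)))) (f.left ≫ π₀) (by
        simp only [Category.assoc]
        rw [sqK.w, reassoc_of% hε, sq₀.w, reassoc_of% (Over.w f)])
  have ha_fst : a ≫ Proj.map _ (ProjBaseChangeRing.irrelevant_le_map R₀ C₀ (Fin (M + 1))) =
      (ι.left ≫ pullback.snd S.hom (projectiveSpace M K).hom) ≫
        Proj.map _ (ProjBaseChangeRing.irrelevant_le_map R₀ K (Fin (M + 1))) :=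
    sqC.lift_fst _ _ _
  have ha_snd : a ≫ pr = f.left ≫ π₀ := sqC.lift_snd _ _ _
  obtain ⟨j, hj_def⟩ : ∃ j : 𝒳.left ⟶ (P₀ ⊗ specOver R₀ K).left,
      j = pullback.lift a 𝒳.hom (by
        change a ≫ pr ≫ (specOver R₀ C₀).hom = _
        rw [reassoc_of% ha_snd, sq₀'.w, reassoc_of% (Over.w f)]) :=
    ⟨_, rfl⟩
  have hj_fst : j ≫ pullback.fst P₀.hom (specOver R₀ K).hom = a := by
    rw [hj_def]; exact pullback.lift_fst _ _ _
  have hj_snd : j ≫ pullback.snd P₀.hom (specOver R₀ K).hom = 𝒳.hom := by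
    rw [hj_def]; exact pullback.lift_snd _ _ _
  have hpKf := Over.whiskerRight_left_fst (R := specOver R₀ K) p₀
  have hpKs := Over.whiskerRight_left_snd (R := specOver R₀ K) p₀
  have hj : j ≫ (p₀ ▷ specOver R₀ K).left = f.left ≫ eS.hom := by
    apply pullback.hom_ext
    · rw [Category.assoc, hpKf, reassoc_of% hj_fst, hp₀, ha_snd, Category.assoc, heS_fst]
    · rw [Category.assoc, hpKs, hj_snd, Category.assoc, heS_snd, Over.w f]
  -- `j` is a closed immersion: `j ≫ ψ = ι.left` for a comparison map `ψ` to `S × ℙᴹ_K`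
  have hw : (pullback.fst P₀.hom (specOver R₀ K).hom ≫
      Proj.map _ (ProjBaseChangeRing.irrelevant_le_map R₀ C₀ (Fin (M + 1)))) ≫
        prR =
      pullback.snd P₀.hom (specOver R₀ K).hom ≫ Spec.map (CommRingCat.ofHom (algebraMap R₀ K)) := by
    rw [Category.assoc, sqC.w]
    exact pullback.condition
  let toP : (P₀ ⊗ specOver R₀ K).left ⟶ Proj (homogeneousSubmodule (Fin (M + 1)) K) :=
    sqK.lift _ _ hw
  have htoP_fst : toP ≫ Proj.map _ (ProjBaseChangeRing.irrelevant_le_map R₀ K (Fin (M + 1))) =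
      pullback.fst P₀.hom (specOver R₀ K).hom ≫
        Proj.map _ (ProjBaseChangeRing.irrelevant_le_map R₀ C₀ (Fin (M + 1))) :=
    sqK.lift_fst _ _ hw
  have htoP_snd : toP ≫ prK = pullback.snd P₀.hom (specOver R₀ K).hom := sqK.lift_snd _ _ hw
  have hwψ : ((p₀ ▷ specOver R₀ K).left ≫ eS.inv) ≫ S.hom =
      toP ≫ (projectiveSpace M K).hom := by
    rw [Category.assoc, heS_inv_snd, hpKs, hPK, htoP_snd]
  let ψ : (P₀ ⊗ specOver R₀ K).left ⟶ (S ⊗ projectiveSpace M K).left := pullback.lift _ _ hwψ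
  have hψ_fst : ψ ≫ pullback.fst S.hom (projectiveSpace M K).hom =
      (p₀ ▷ specOver R₀ K).left ≫ eS.inv := pullback.lift_fst _ _ hwψ
  have hψ_snd : ψ ≫ pullback.snd S.hom (projectiveSpace M K).hom = toP := pullback.lift_snd _ _ hwψ
  have hjψ : j ≫ ψ = ι.left := by
    apply pullback.hom_ext
    · rw [Category.assoc, hψ_fst, reassoc_of% hj, Iso.hom_inv_id, Category.comp_id, hιfst]
    · rw [Category.assoc, hψ_snd]
      apply sqK.hom_ext
      · rw [Category.assoc, htoP_fst, reassoc_of% hj_fst, ha_fst]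
      · rw [Category.assoc, htoP_snd, hj_snd, Category.assoc, hε]
  haveI : IsSeparated (pullback.snd P₀.hom (specOver R₀ K).hom) := inferInstance
  haveI : IsSeparated (ψ ≫ pullback.fst S.hom (projectiveSpace M K).hom ≫ S.hom) := by
    rw [← Category.assoc, hψ_fst, Category.assoc, heS_inv_snd, hpKs]
    infer_instance
  haveI : IsSeparated ψ := IsSeparated.of_comp ψ (pullback.fst S.hom (projectiveSpace M K).hom ≫ S.hom)
  haveI : IsClosedImmersion (j ≫ ψ) := by rw [hjψ]; infer_instance
  haveI : IsClosedImmersion j := IsClosedImmersion.of_comp j ψ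
  -- smoothness hypotheses of the stage descent
  haveI : SmoothOfRelativeDimension n (j ≫ (p₀ ▷ specOver R₀ K).left) := by
    rw [hj, MorphismProperty.cancel_right_of_respectsIso (P := @SmoothOfRelativeDimension n)]
    infer_instance
  haveI : SmoothOfRelativeDimension d
      (pullback.snd (specOver R₀ C₀).hom (specOver R₀ K).hom) := by
    rw [← heS_inv_snd, MorphismProperty.cancel_left_of_respectsIso (P := @SmoothOfRelativeDimension d)]
    infer_instance
  -- 4. the stage descent
  obtain ⟨T, _, _, _, _, _, hTft, Y, imm, _, πX, φ, hYn, hYd, hφ₁, hφ₂, Hsq⟩ :=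
    exists_stage_closedSubscheme_smoothOfRelativeDimension (n := n) (d := d) P₀ p₀ j
  -- 5. the base ring `B = T ⊗_{R₀} C₀` (kept opaque) and its cartesian square
  obtain ⟨B, _, _, algCB, hBft, sqB⟩ : ∃ (B : Type u) (_ : CommRing B) (_ : Algebra T B)
      (_ : Algebra C₀ B), Algebra.FiniteType T B ∧
      IsPullback (Spec.map (CommRingCat.ofHom (algebraMap C₀ B)))
        (Spec.map (CommRingCat.ofHom (algebraMap T B)))
        (specOver R₀ C₀).hom (specOver R₀ T).hom := by
    letI : Algebra C₀ (T ⊗[R₀] C₀) := Algebra.TensorProduct.rightAlgebra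
    exact ⟨T ⊗[R₀] C₀, inferInstance, inferInstance, inferInstance, inferInstance,
      isPullback_specMap_includeRight (K := T) (R := (R₀ : Type u)) C₀⟩
  letI := MvPolynomial.gradedAlgebra (σ := Fin (M + 1)) (R := B)
  haveI : Algebra.FiniteType ℤ T :=
    Algebra.FiniteType.trans (inferInstance : Algebra.FiniteType ℤ R₀) hTft
  -- `Spec C₀ ⊗ Spec T ≅ Spec B`
  have sqQT := IsPullback.of_hasPullback (specOver R₀ C₀).hom (specOver R₀ T).hom
  let eQ : (specOver R₀ C₀ ⊗ specOver R₀ T).left ≅ Spec (.of B) := sqQT.isoIsPullback _ _ sqB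
  have heQ_fst : eQ.hom ≫ Spec.map (CommRingCat.ofHom (algebraMap C₀ B)) =
      pullback.fst (specOver R₀ C₀).hom (specOver R₀ T).hom := sqQT.isoIsPullback_hom_fst _ _ _
  have heQ_snd : eQ.hom ≫ Spec.map (CommRingCat.ofHom (algebraMap T B)) =
      pullback.snd (specOver R₀ C₀).hom (specOver R₀ T).hom := sqQT.isoIsPullback_hom_snd _ _ _
  -- `ℙᴹ_{C₀} ⊗ Spec T ≅ ℙᴹ_B`
  obtain ⟨prB, hprB⟩ : ∃ prB : Proj (homogeneousSubmodule (Fin (M + 1)) B) ⟶ Spec (.of B),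
      prB = projToSpec (Fin (M + 1)) B := ⟨_, rfl⟩
  have sqPB : IsPullback (Proj.map _ (ProjBaseChangeRing.irrelevant_le_map C₀ B (Fin (M + 1)))) prB
      pr (Spec.map (CommRingCat.ofHom (algebraMap C₀ B))) := by
    rw [hpr, hprB]; exact ProjBaseChangeRing.isPullback_projMap' (k := C₀) (L := B) (n := M)
  have hpTf := Over.whiskerRight_left_fst (R := specOver R₀ T) p₀
  have hpTs := Over.whiskerRight_left_snd (R := specOver R₀ T) p₀
  have sqSrc : IsPullback (pullback.fst P₀.hom (specOver R₀ T).hom)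
      ((p₀ ▷ specOver R₀ T).left ≫ eQ.hom) pr (Spec.map (CommRingCat.ofHom (algebraMap C₀ B))) := by
    refine IsPullback.of_bot ?_ ?_ sqB
    · rw [Category.assoc, heQ_snd, hpTs]
      exact IsPullback.of_hasPullback P₀.hom (specOver R₀ T).hom
    · rw [Category.assoc, heQ_fst, hpTf, hp₀]
  let E : (P₀ ⊗ specOver R₀ T).left ≅ Proj (homogeneousSubmodule (Fin (M + 1)) B) :=
    sqSrc.isoIsPullback _ _ sqPB
  have hE_snd : E.hom ≫ prB = (p₀ ▷ specOver R₀ T).left ≫ eQ.hom := sqSrc.isoIsPullback_hom_snd _ _ _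
  -- 6. the model `Y ↪ ℙᴹ_B`, its structure morphism, and the base point `π : S → Spec B`
  obtain ⟨emb, hemb_def⟩ : ∃ emb : Y ⟶ Proj (homogeneousSubmodule (Fin (M + 1)) B),
      emb = imm ≫ E.hom := ⟨_, rfl⟩
  haveI : IsClosedImmersion emb := by rw [hemb_def]; infer_instance
  obtain ⟨g, hg_def⟩ : ∃ g : Y ⟶ Spec (.of B), g = emb ≫ prB := ⟨_, rfl⟩
  have hg : g = (imm ≫ (p₀ ▷ specOver R₀ T).left) ≫ eQ.hom := by
    rw [hg_def, hemb_def, Category.assoc, hE_snd, Category.assoc]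
  haveI hprBproper : IsProper prB := by
    rw [hprB]; exact ProjBaseChangeRing.isProper_projToSpec _ B
  haveI : IsProper g := by rw [hg_def]; infer_instance
  have hgn : SmoothOfRelativeDimension n g := by
    rw [hg, MorphismProperty.cancel_right_of_respectsIso (P := @SmoothOfRelativeDimension n)]
    exact hYn
  have hBd : SmoothOfRelativeDimension d (Spec.map (CommRingCat.ofHom (algebraMap T B))) := by
    rw [(Iso.eq_inv_comp eQ).mpr heQ_snd,
      MorphismProperty.cancel_left_of_respectsIso (P := @SmoothOfRelativeDimension d)]
    exact hYd
  -- `π : S → Spec B`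
  have hRT : (specOver R₀ K).hom = Spec.map (CommRingCat.ofHom (algebraMap T K)) ≫
      (specOver R₀ T).hom := by
    change Spec.map _ = Spec.map _ ≫ Spec.map _
    rw [← Spec.map_comp, ← CommRingCat.ofHom_comp, ← IsScalarTower.algebraMap_eq]
  have hwπ : π₀ ≫ (specOver R₀ C₀).hom =
      (S.hom ≫ Spec.map (CommRingCat.ofHom (algebraMap T K))) ≫ (specOver R₀ T).hom := by
    rw [Category.assoc, ← hRT]; exact sq₀'.w
  let π : S.left ⟶ Spec (.of B) := sqB.lift π₀ (S.hom ≫ Spec.map (CommRingCat.ofHom (algebraMap T K))) hwπ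
  have hπ_fst : π ≫ Spec.map (CommRingCat.ofHom (algebraMap C₀ B)) = π₀ := sqB.lift_fst _ _ hwπ
  have hπ_snd : π ≫ Spec.map (CommRingCat.ofHom (algebraMap T B)) =
      S.hom ≫ Spec.map (CommRingCat.ofHom (algebraMap T K)) := sqB.lift_snd _ _ hwπ
  have Hπ : IsPullback π S.hom (Spec.map (CommRingCat.ofHom (algebraMap T B)))
      (Spec.map (CommRingCat.ofHom (algebraMap T K))) := by
    refine IsPullback.of_right ?_ hπ_snd sqB
    rw [hπ_fst, ← hRT]
    exact sq₀'
  -- 7. the cartesian square `(π𝒳, f; g, π)`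
  let b : specOver R₀ K ⟶ specOver R₀ T :=
    Over.homMk (Spec.map (CommRingCat.ofHom (algebraMap T K))) hRT.symm
  have hb : b.left = Spec.map (CommRingCat.ofHom (algebraMap T K)) := rfl
  have hPbf := Over.whiskerLeft_left_fst (R := P₀) b
  have hPbs := Over.whiskerLeft_left_snd (R := P₀) b
  have hQbf := Over.whiskerLeft_left_fst (R := specOver R₀ C₀) b
  have hQbs := Over.whiskerLeft_left_snd (R := specOver R₀ C₀) b
  have hφb : φ = (P₀ ◁ b).left := by
    apply pullback.hom_ext
    · rw [hφ₁, hPbf]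
    · rw [hφ₂, hPbs, hb]
  have sqW := LocApprox.isPullback_whiskerLeft_whiskerRight_left p₀ (specOver R₀ T) b
  have HXQ : IsPullback πX (j ≫ (p₀ ▷ specOver R₀ K).left) (imm ≫ (p₀ ▷ specOver R₀ T).left)
      ((specOver R₀ C₀) ◁ b).left := by
    have h1 : IsPullback πX j imm (P₀ ◁ b).left := by rw [← hφb]; exact Hsq.flip
    exact h1.paste_vert sqW
  have hπb : (specOver R₀ C₀ ◁ b).left ≫ eQ.hom = eS.inv ≫ π := by
    rw [Iso.eq_inv_comp]
    apply sqB.hom_ext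
    · rw [Category.assoc, Category.assoc, heQ_fst, hQbf, hπ_fst, heS_fst]
    · rw [Category.assoc, Category.assoc, heQ_snd, hQbs, hπ_snd, hb, ← Category.assoc, heS_snd]
  have H𝒳 : IsPullback πX f.left g π := by
    refine HXQ.of_iso (Iso.refl _) (Iso.refl _) eS.symm eQ (by simp) ?_ ?_ ?_
    · rw [hj, Iso.symm_hom, Category.assoc, Iso.hom_inv_id, Category.comp_id, Iso.refl_hom,
        Category.id_comp]
    · rw [hg, Iso.refl_hom, Category.id_comp]
    · rw [hπb, Iso.symm_hom]
  -- 8. assembly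
  exact ⟨T, inferInstance, inferInstance, inferInstance, B, inferInstance, inferInstance, hBft, π, Y,
    g, emb, inferInstance, by rw [hg_def, hprB], πX, hBd, Hπ, inferInstance, hgn, H𝒳⟩

end Literature.AlgebraicGeometry.Limits

end
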